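import Literature.AlgebraicGeometry.Motives.AbelianVarietyPicZeroOfAmple
import Literature.AlgebraicGeometry.Motives.AbelianVarietyKummerPairingPoints
import Literature.Geometry.Kaehler.ComplexTorusLineBundleLocalTheta
import Literature.Geometry.Kaehler.ComplexTorusKernelPolarizationPairing
import HarnessLib

/-!
# The analytic unit of a trivialised torsion divisor class on a complex abelian variety
# (towards «algebraic Kummer pairing = analytic torsion pairing», Lange 2023 §2.7.4 Ex. (3) / Lang VII §2)

Layer `Literature/AlgebraicGeometry/Motives`, namespace `Literature.AlgebraicGeometry.Motives.AbelianVariety`.  PROOF FILE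
(theorems only; no definition, no named fact).  Setting (the J′ variable block of the tree's
`AbelianVarietyUniformisationPicard` / `AbelianVarietyPicZeroOfAmple`): a complex abelian variety `A` uniformised by a
complex torus, `φ : X = V/Λ → A(ℂ)` an analytification which is a group homomorphism; a Cartier divisor `E` on `A`, a
level `N` with `[N]_A` dominant and a TRIVIALIZER `h ∈ K(A)` of `[N]^* E` (`[N]^* E + div h = 0`,
`AbelianVariety.IsTrivializer`); and a point `t` of the dual torus `X̂` whose class `L(0, χ_t) ∈ Pic⁰(X)` is the class of
the holomorphic line bundle `𝒪(E)^an` (`cartierDivisorLineBundle hφ E`).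

MAIN RESULT `exists_kummerUnit`: there are local theta functions `G_i : V → ℂ` of `𝒪(E)^an` for the character `χ_t`
(one for each open `U_i` of the Cartier data of `E`; from the tree's `ComplexTorus.exists_localTheta_of_isTrivialOn_tensor_inv`)
and a NON-ZERO CONSTANT `c₀` such that for every `v ∈ V` and every local section `w` representing the unit
`([N]^♯ f_i) · h` near `x = φ(π v)` (with `[N] x ∈ U_i`):  `w(x) = c₀ · G_i(N v)`.  Moreover `χ_t(N λ) = 1` for all
`λ ∈ Λ`, i.e. `N t = 0` in `X̂`.  In words: the algebraic unit `([N]^♯ f_i) h`, read on `V` and divided by the local theta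
function `G_i ∘ N`, is an entire nowhere-vanishing function with unitary lattice multipliers `χ_t(Nλ)⁻¹`, hence CONSTANT
(Liouville, the tree's `ComplexTorus.thetaFunction_apply_eq_of_norm_eq_one`), and the multipliers are `1`.  This is the
analytic heart of the comparison «`e_N(σ, E) = χ_t(N σ̃)`» (sequel file), done WITHOUT forming any meromorphic function.

## References
* [Lange2023AbelianVarietiesComplex] H. Lange, *Abelian Varieties over the Complex Numbers* (2023), §1.2.1 Prop. 1.2.3,
  §1.3.2 Thm. 1.3.3 (proof: Liouville), §1.4.1 Prop. 1.4.1, §2.7.4 Exercise (3).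
* [Lang1983AbelianVarieties] S. Lang, *Abelian Varieties*, Ch. VII §2, Props. 3–5 (the Kummer pairing via `[N]^* E + div h = 0`).
-/

noncomputable section


open CategoryTheory AlgebraicGeometry TopologicalSpace Set Function Filter
open scoped Manifold Topology
open Literature.Geometry.Kaehler Literature.Geometry.Kaehler.ComplexTorus
open Literature.NumberTheory.Transcendental Literature.AlgebraicGeometry.HodgeTheory

namespace Literature.AlgebraicGeometry.Motives.AbelianVariety

open RatFn AlgPoints

section KummerUnit

variable (A : AbelianVariety ℂ) {ι : Type} [Fintype ι] [DecidableEq ι] {Φ : (ι → ℝ) ≃L[ℝ] (Fin A.dim → ℂ)}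
  {φ : ComplexTorus Φ → ComplexPoints A.X} (hφ : IsAnalytification (Fin A.dim → ℂ) A.X A.dim φ)
  (hadd : ∀ x y, φ (x + y) = φ x * φ y)

/-! ### §0 Book-keeping: the covering map, `[N]` on points, the character `χ_t` -/

omit [Fintype ι] [DecidableEq ι] in
/-- `π (z + w) = π z + π w` for the covering map `π : V → V/Λ`. [cite: Lange2023AbelianVarietiesComplex, §1.1] -/
theorem cover_add' (z w : Fin A.dim → ℂ) : cover Φ (z + w) = cover Φ z + cover Φ w := by
  rw [cover_apply, cover_apply, cover_apply, map_add, proj_add]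

omit [Fintype ι] [DecidableEq ι] in
include hadd in
/-- `φ (π (N v)) = φ(π v)^N`: the uniformisation is a homomorphism. [cite: Lange2023AbelianVarietiesComplex, §1.1] -/
theorem map_cover_nsmul (N : ℕ) (v : Fin A.dim → ℂ) : φ (cover Φ (N • v)) = φ (cover Φ v) ^ N := by
  induction N with
  | zero =>
    have h0 : φ 0 = 1 := by
      have h := hadd 0 0
      rw [add_zero] at h
      exact mul_eq_left.mp h.symm
    rw [zero_smul, pow_zero, ← h0]
    congr 1
    have := cover_add' A (Φ := Φ) (0 : Fin A.dim → ℂ) 0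
    rw [add_zero] at this
    exact left_eq_add.mp this
  | succ n ih => rw [succ_nsmul, cover_add' A, hadd, ih, pow_succ]

/-- On `L`-points, `[N]_A` is the `N`-th power: `map [N] x = x ^ N` (`[n]_A` is the `n`-th power map of the group
object `A`; Mumford §4 (iv)). [cite: MumfordAV1970, §4 (iv) and §6 Application 2 (p. 63)] -/
theorem map_zsmul_one (N : ℕ) (x : A.Points ℂ) :
    AlgPoints.map (((N : ℤ) • 𝟙 A).hom.hom.hom) x = x ^ N := by
  rw [AlgPoints.map_apply, hom_zsmul_id, GrpObj.comp_zpow, Category.comp_id, zpow_natCast]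

omit [DecidableEq ι] in
/-- `|χ_t(λ)| = 1`: the character of a dual point is unitary. [cite: Lange2023AbelianVarietiesComplex, §1.4.1 Prop. 1.4.1] -/
theorem norm_pointChar [DecidableEq ι] (t : Dual Φ) (n : ι → ℤ) : ‖pointChar Φ t n‖ = 1 :=
  norm_dualChar Φ _ n

/-- `χ_t(N λ) = χ_t(λ)^N`. [cite: Lange2023AbelianVarietiesComplex, §1.4.1 Prop. 1.4.1] -/
theorem pointChar_nsmul (t : Dual Φ) (N : ℕ) (n : ι → ℤ) : pointChar Φ t (N • n) = pointChar Φ t n ^ N := by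
  unfold pointChar
  induction N with
  | zero => rw [zero_smul, pow_zero, dualChar_zero_right]
  | succ k ih => rw [succ_nsmul, dualChar_add_right, ih, pow_succ]

omit [Fintype ι] [DecidableEq ι] in
/-- `N • Φ(n) = Φ(N • n)` for lattice vectors. [cite: Lange2023AbelianVarietiesComplex, §1.1] -/
theorem nsmul_latticeVec (N : ℕ) (n : ι → ℤ) : N • latticeVec Φ n = latticeVec Φ (N • n) := by
  rw [latticeVec, latticeVec, ← map_nsmul]
  congr 1
  funext i
  simp

/-! ### §1 The factor of the dual point `t` and the triviality of `𝒪(D)^an ⊗ L_{χ_t⁻¹}` -/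

/-- The factor of automorphy `a_{(0, χ_t)}` of the dual point `t` is the CONSTANT cocycle `χ_t`.
[cite: Lange2023AbelianVarietiesComplex, §1.3.1 (1.11) and §1.4.1 Prop. 1.4.1] -/
theorem toFactor_dualToAH_apply (t : Dual Φ) (n : ι → ℤ) (v : Fin A.dim → ℂ) :
    (AHData.toFactor (dualToAH Φ t) : (ι → ℤ) → (Fin A.dim → ℂ) → ℂ) n v = pointChar Φ t n := by
  rw [AHData.toFactor_apply, dualToAH_form, dualToAH_char, canonicalFactor_zero_left]

/-- If `L(0, χ_t) = [𝒪(D)^an]` in `Pic(X)` then `𝒪(D)^an ⊗ L_{χ_t⁻¹}` is holomorphically trivial on `X`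
(`picClass_eq_toPic_iff`). [cite: Lange2023AbelianVarietiesComplex, §1.2.1 Prop. 1.2.2–1.2.3 (p. 21)] -/
theorem isTrivialOn_cartierDivisorLineBundle_tensor_inv (D : CartierDivisor A.X.left) (t : Dual Φ)
    (ht : ((dualEquivPicZero Φ (Multiplicative.ofAdd t) : picZero Φ) : Pic Φ) =
      picClass (cartierDivisorLineBundle hφ D)) :
    ((cartierDivisorLineBundle hφ D).tensor
      (factorLineBundle (AHData.toFactor (dualToAH Φ t)).isFactor.inv)).IsTrivialOn univ := by
  have h1 : picClass (cartierDivisorLineBundle hφ D) = (AHData.toFactor (dualToAH Φ t)).toPic := by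
    rw [← ht, coe_dualEquivPicZero_apply]
    rfl
  exact (picClass_eq_toPic_iff _ _).1 h1

/-! ### §2 The analytic unit -/

/-- Values of equal rational functions agree (two sections over opens containing the point). [folklore] -/
private theorem evalOrZero_eq_of_ofSection_eq {k : Type} [Field k] {X : SchemeOver k} {L : Type} [Field L]
    [Algebra k L] [IsIntegral X.left] {O₁ O₂ : X.left.Opens} (s₁ : Γ(X.left, O₁)) (s₂ : Γ(X.left, O₂))
    {P : AlgPoints X L} (h₁ : P.pt ∈ O₁) (h₂ : P.pt ∈ O₂)
    (H : ofSection (genericPoint_mem_of_mem h₁) s₁ = ofSection (genericPoint_mem_of_mem h₂) s₂) :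
    evalOrZero O₁ s₁ P = evalOrZero O₂ s₂ P := by
  have hO : P.pt ∈ O₁ ⊓ O₂ := ⟨h₁, h₂⟩
  rw [← AlgPoints.evalOrZero_map_homOfLE (inf_le_left : O₁ ⊓ O₂ ≤ O₁) s₁ hO,
    ← AlgPoints.evalOrZero_map_homOfLE (inf_le_right : O₁ ⊓ O₂ ≤ O₂) s₂ hO]
  congr 1
  refine RatFn.section_ext fun hg ↦ ?_
  simp only [RatFn.ofSection_map]
  exact H

variable {A}

include hadd in
/-- **The analytic unit of a trivialised torsion class is CONSTANT.**  In the setting of the module docstring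
(`hh : [N]^* D + div h = 0`, `ht : L(0, χ_t) = [𝒪(D)^an]`): there are local theta functions `G_i` of `𝒪(D)^an` for
`χ_t` (holomorphic and nowhere zero over `U_i`, `G_i(v + Φ n) = χ_t(n) G_i(v)`) and a constant `c₀ ≠ 0` such that
for every `v ∈ V`, every index `i` with `[N](φ π v) ∈ U_i` and every section `w` representing the unit
`([N]^♯ f_i) · h` near `φ(π v)`:  `w(φ π v) · G_i(N v) = c₀`; moreover `χ_t(N n) = 1` for all `n ∈ ℤ^ι` (Liouville:
the product is an entire nowhere-zero function with unitary lattice multipliers `χ_t(N n)`).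
[cite: Lange2023AbelianVarietiesComplex, §1.3.2 Thm. 1.3.3 (proof: Liouville) and §2.7.4 Exercise (3)]
[cite: Lang1983AbelianVarieties, Ch. VII §2 Props. 3–5] -/
theorem exists_kummerUnit {N : ℕ} [IsDominant (Hom.toSchemeHom ((N : ℤ) • 𝟙 A))]
    (D : CartierDivisor A.X.left) {h : A.X.left.functionField} (hh : A.IsTrivializer (n := N) D h)
    (t : Dual Φ)
    (ht : ((dualEquivPicZero Φ (Multiplicative.ofAdd t) : picZero Φ) : Pic Φ) =
      picClass (cartierDivisorLineBundle hφ D)) :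
    ∃ (G : D.ι → (Fin A.dim → ℂ) → ℂ) (c₀ : ℂ), c₀ ≠ 0 ∧
      (∀ i (n : ι → ℤ) (v : Fin A.dim → ℂ), G i (v + latticeVec Φ n) = pointChar Φ t n * G i v) ∧
      (∀ i (v : Fin A.dim → ℂ), (φ (cover Φ v)).pt ∈ D.U i → G i v ≠ 0) ∧
      (∀ n : ι → ℤ, pointChar Φ t (N • n) = 1) ∧
      ∀ (i : D.ι) (v : Fin A.dim → ℂ) (O : A.X.left.Opens) (w : Γ(A.X.left, O))
        (hO : (φ (cover Φ v)).pt ∈ O) (_ : (φ (cover Φ (N • v))).pt ∈ D.U i)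
        (_ : ofSection (genericPoint_mem_of_mem hO) w =
          functionFieldMap (Hom.toSchemeHom ((N : ℤ) • 𝟙 A)) (D.f i) * h),
        evalOrZero O w (φ (cover Φ v)) * G i (N • v) = c₀ := by
  classical
  -- §1 the local theta functions of `𝒪(D)^an` for `χ_t`
  set L := cartierDivisorLineBundle hφ D with hLdef
  obtain ⟨G, hGd, hG0, hGe, hGc⟩ := exists_localTheta_of_isTrivialOn_tensor_inv L
    (AHData.toFactor (dualToAH Φ t)).isFactor (isTrivialOn_cartierDivisorLineBundle_tensor_inv A hφ D t ht)
  have hGe' : ∀ i (n : ι → ℤ) (v : Fin A.dim → ℂ), G i (v + latticeVec Φ n) = pointChar Φ t n * G i v := by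
    intro i n v
    rw [hGe, toFactor_dualToAH_apply]
  have hbase : ∀ i (m : ComplexTorus Φ), m ∈ L.baseSet i ↔ (φ m).pt ∈ D.U i := fun i m ↦ Iff.rfl
  -- the morphism `[N]` and the points `x_v = φ(π v)`, `[N] x_v = φ(π (N v))`
  set zN : A.X ⟶ A.X := ((N : ℤ) • 𝟙 A).hom.hom.hom with hzN
  have hzNleft : Hom.toSchemeHom ((N : ℤ) • 𝟙 A) = zN.left := rfl
  have hNpt : ∀ v : Fin A.dim → ℂ, AlgPoints.map zN (φ (cover Φ v)) = φ (cover Φ (N • v)) := by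
    intro v
    rw [hzN, map_zsmul_one, map_cover_nsmul A hadd]
  have hNpt' : ∀ v : Fin A.dim → ℂ, zN.left (φ (cover Φ v)).pt = (φ (cover Φ (N • v))).pt := by
    intro v
    rw [← hNpt, AlgPoints.pt_map]
  -- the units `r_i = ([N]^♯ f_i) · h`, regular (indeed invertible) on `W_i = [N]⁻¹ U_i`
  set r : D.ι → A.X.left.functionField := fun i ↦ functionFieldMap zN.left (D.f i) * h with hrdef
  set W : D.ι → A.X.left.Opens := fun i ↦ zN.left ⁻¹ᵁ (D.U i) with hWdef
  have hunit : ∀ i (y : A.X.left), y ∈ W i → IsUnitAt y (r i) := fun i y hy ↦ hh.2 i y hy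
  have hmemW : ∀ i (v : Fin A.dim → ℂ), (φ (cover Φ (N • v))).pt ∈ D.U i → (φ (cover Φ v)).pt ∈ W i := by
    intro i v hi
    change zN.left (φ (cover Φ v)).pt ∈ D.U i
    rwa [hNpt']
  -- (A) values of `r_i` at `x_v` through two representing sections agree, and change with `i` by the cocycle of `L`
  have hval : ∀ (i j : D.ι) (v : Fin A.dim → ℂ) (O O' : A.X.left.Opens) (w : Γ(A.X.left, O)) (w' : Γ(A.X.left, O'))
      (hO : (φ (cover Φ v)).pt ∈ O) (hO' : (φ (cover Φ v)).pt ∈ O')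
      (hi : (φ (cover Φ (N • v))).pt ∈ D.U i) (hj : (φ (cover Φ (N • v))).pt ∈ D.U j)
      (hw : ofSection (genericPoint_mem_of_mem hO) w = r i) (hw' : ofSection (genericPoint_mem_of_mem hO') w' = r j),
      evalOrZero O' w' (φ (cover Φ v)) = L.coordChange i j (cover Φ (N • v)) * evalOrZero O w (φ (cover Φ v)) := by
    intro i j v O O' w w' hO hO' hi hj hw hw'
    -- `r_j = [N]^♯(f_j / f_i) · r_i` and `[N]^♯ (f_j/f_i)` is the section `[N]^* transFun j i`
    have hij : (φ (cover Φ v)).pt ∈ zN.left ⁻¹ᵁ (D.U j ⊓ D.U i) := by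
      change zN.left (φ (cover Φ v)).pt ∈ D.U j ⊓ D.U i
      rw [hNpt']
      exact ⟨hj, hi⟩
    have hgen : genericPoint A.X.left ∈ D.U j ⊓ D.U i := genericPoint_mem_of_mem (show (φ (cover Φ (N • v))).pt ∈ D.U j ⊓ D.U i from ⟨hj, hi⟩)
    have hfi : D.f i ≠ 0 := D.f_ne_zero i
    have H : ofSection (genericPoint_mem_of_mem hO') w' =
        ofSection (genericPoint_mem_of_mem hij) (zN.left.app _ (D.transFun j i)) *
          ofSection (genericPoint_mem_of_mem hO) w := by
      rw [hw', hw, ← functionFieldMap_ofSection zN.left hgen (D.transFun j i), CartierDivisor.ofSection_transFun,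
        hrdef]
      simp only
      rw [map_div₀]
      have hfi' : functionFieldMap zN.left (D.f i) ≠ 0 := (map_ne_zero _).2 hfi
      field_simp
    rw [AlgPoints.evalOrZero_eq_mul_of_ofSection_eq _ _ _ hO' hij hO H, ← AlgPoints.evalOrZero_map, hNpt]
    rfl
  -- canonical sections `wsec i ∈ Γ(W_i)` of the units `r_i`
  have hWsec : ∀ i, ∃ w : Γ(A.X.left, W i), ∀ hW : genericPoint A.X.left ∈ W i, ofSection hW w = r i := by
    intro i
    by_cases hW : genericPoint A.X.left ∈ W i
    · exact ⟨sectionOf hW (r i) (fun y hy ↦ (hunit i y hy).isRegularAt), fun _ ↦ ofSection_sectionOf _ _ _⟩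
    · exact ⟨0, fun hW' ↦ absurd hW' hW⟩
  choose wsec hwsec using hWsec
  -- a preferred index `idx v` with `[N] x_v ∈ U_{idx v}`, and the product `u`
  have hidx' : ∀ v : Fin A.dim → ℂ, ∃ i, (φ (cover Φ (N • v))).pt ∈ D.U i := fun v ↦ D.covers _
  choose idx hidx using hidx'
  set u : (Fin A.dim → ℂ) → ℂ := fun v ↦
    evalOrZero (W (idx v)) (wsec (idx v)) (φ (cover Φ v)) * G (idx v) (N • v) with hudef
  -- (U1) `u` does not depend on the index nor on the representing section
  have hu : ∀ (i : D.ι) (v : Fin A.dim → ℂ) (O : A.X.left.Opens) (w : Γ(A.X.left, O))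
      (hO : (φ (cover Φ v)).pt ∈ O) (hi : (φ (cover Φ (N • v))).pt ∈ D.U i)
      (hw : ofSection (genericPoint_mem_of_mem hO) w = r i),
      evalOrZero O w (φ (cover Φ v)) * G i (N • v) = u v := by
    intro i v O w hO hi hw
    have hj : (φ (cover Φ (N • v))).pt ∈ D.U (idx v) := hidx v
    have hxW : (φ (cover Φ v)).pt ∈ W (idx v) := hmemW _ v hj
    have h1 := hval i (idx v) v O (W (idx v)) w (wsec (idx v)) hO hxW hi hj hw (hwsec _ _)
    have h2 := hGc i (idx v) (N • v) ((hbase i _).2 hi) ((hbase _ _).2 hj)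
    simp only [hudef]
    rw [h1, h2]
    ring
  -- `N • v` as a complex scalar multiple (for continuity / holomorphy of `v ↦ N • v`)
  have hNsmul : (fun v : Fin A.dim → ℂ ↦ N • v) = fun v ↦ (N : ℂ) • v :=
    funext fun v ↦ (Nat.cast_smul_eq_nsmul ℂ N v).symm
  have hcontN : Continuous fun v : Fin A.dim → ℂ ↦ φ (cover Φ (N • v)) := by
    have : (fun v : Fin A.dim → ℂ ↦ φ (cover Φ (N • v))) = fun v ↦ φ (cover Φ ((N : ℂ) • v)) := by
      funext v
      rw [← Nat.cast_smul_eq_nsmul ℂ N v]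
    rw [this]
    exact hφ.isHomeomorph.continuous.comp ((continuous_cover Φ).comp (continuous_const_smul (N : ℂ)))
  -- (U2) `u` is entire
  have hu_diff : Differentiable ℂ u := by
    intro v₀
    have hi : (φ (cover Φ (N • v₀))).pt ∈ D.U (idx v₀) := hidx v₀
    have hopen : IsOpen {v : Fin A.dim → ℂ | (φ (cover Φ (N • v))).pt ∈ D.U (idx v₀)} :=
      (AlgPoints.isOpen_setOf_pt_mem (D.U (idx v₀))).preimage hcontN
    have hev : u =ᶠ[𝓝 v₀]
        fun v ↦ evalOrZero (W (idx v₀)) (wsec (idx v₀)) (φ (cover Φ v)) * G (idx v₀) (N • v) := by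
      filter_upwards [hopen.mem_nhds hi] with v hv
      exact (hu (idx v₀) v (W (idx v₀)) (wsec (idx v₀)) (hmemW _ v hv) hv (hwsec _ _)).symm
    refine DifferentiableAt.congr_of_eventuallyEq ?_ hev
    refine DifferentiableAt.mul ?_ ?_
    · have hW' : (φ (cover Φ v₀)).pt ∈ W (idx v₀) := hmemW _ v₀ hi
      have hmd : MDifferentiableOn 𝓘(ℂ, Fin A.dim → ℂ) 𝓘(ℂ, ℂ)
          (fun m ↦ evalOrZero (W (idx v₀)) (wsec (idx v₀)) (φ m)) (φ ⁻¹' {P | P.pt ∈ W (idx v₀)}) :=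
        IsAnalytification.mdifferentiableOn_evalOrZero_opens_holds hφ (W (idx v₀)) (wsec (idx v₀))
      have hat : MDifferentiableAt 𝓘(ℂ, Fin A.dim → ℂ) 𝓘(ℂ, ℂ)
          (fun m ↦ evalOrZero (W (idx v₀)) (wsec (idx v₀)) (φ m)) (cover Φ v₀) :=
        hmd.mdifferentiableAt ((hφ.isOpen_preimage (W (idx v₀))).mem_nhds hW')
      exact mdifferentiableAt_iff_differentiableAt.mp (hat.comp v₀ (mdifferentiable_cover Φ (𝕜 := ℂ) v₀))
    · have hmem : (N : ℂ) • v₀ ∈ cover Φ ⁻¹' L.baseSet (idx v₀) := by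
        rw [Nat.cast_smul_eq_nsmul]
        exact (hbase _ _).2 hi
      have hd : DifferentiableAt ℂ (G (idx v₀)) ((N : ℂ) • v₀) :=
        (hGd _).differentiableAt
          (((L.isOpen_baseSet _).preimage (continuous_cover Φ)).mem_nhds hmem)
      have hcomp : DifferentiableAt ℂ (fun v : Fin A.dim → ℂ ↦ G (idx v₀) ((N : ℂ) • v)) v₀ :=
        hd.comp v₀ (differentiableAt_id.const_smul (N : ℂ))
      have heq : (fun v : Fin A.dim → ℂ ↦ G (idx v₀) (N • v)) = fun v ↦ G (idx v₀) ((N : ℂ) • v) := by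
        funext v
        rw [← Nat.cast_smul_eq_nsmul ℂ N v]
      rw [heq]
      exact hcomp
  -- (U3) `u` does not vanish
  have hu_ne : ∀ v, u v ≠ 0 := by
    intro v
    have hi := hidx v
    have hxW := hmemW (idx v) v hi
    refine mul_ne_zero ?_ (hG0 _ _ ((hbase _ _).2 hi))
    have hunit' : IsUnitAt (φ (cover Φ v)).pt (ofSection (genericPoint_mem_of_mem hxW) (wsec (idx v))) := by
      rw [hwsec]
      exact hunit _ _ hxW
    exact (isUnitAt_ofSection_iff_evalOrZero_ne_zero (wsec (idx v)) hxW).1 hunit'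
  -- (U4) `u` is a theta function for the constant factor `n ↦ χ_t(N n)`
  have hu_theta : u ∈ thetaFunctions Φ (fun n (_ : Fin A.dim → ℂ) ↦ pointChar Φ t (N • n)) := by
    refine ⟨hu_diff, fun n v ↦ ?_⟩
    have hi : (φ (cover Φ (N • v))).pt ∈ D.U (idx v) := hidx v
    have hcov : cover Φ (v + latticeVec Φ n) = cover Φ v := cover_add_latticeVec Φ v n
    have hNv : N • (v + latticeVec Φ n) = N • v + latticeVec Φ (N • n) := by
      rw [smul_add, nsmul_latticeVec A]
    have hcovN : cover Φ (N • (v + latticeVec Φ n)) = cover Φ (N • v) := by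
      rw [hNv, cover_add_latticeVec]
    have hi' : (φ (cover Φ (N • (v + latticeVec Φ n)))).pt ∈ D.U (idx v) := by
      rwa [hcovN]
    have hxW' : (φ (cover Φ (v + latticeVec Φ n))).pt ∈ W (idx v) := hmemW _ _ hi'
    rw [← hu (idx v) (v + latticeVec Φ n) (W (idx v)) (wsec (idx v)) hxW' hi' (hwsec _ _),
      ← hu (idx v) v (W (idx v)) (wsec (idx v)) (hmemW _ v hi) hi (hwsec _ _), hNv, hGe', hcov]
    ring
  -- (U5) Liouville
  have hψ : ∀ n : ι → ℤ, ‖pointChar Φ t (N • n)‖ = 1 := fun n ↦ norm_pointChar A t _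
  have hone : (fun n : ι → ℤ ↦ pointChar Φ t (N • n)) = 1 :=
    eq_one_of_thetaFunction_ne_zero Φ hψ hu_theta (hu_ne 0)
  refine ⟨G, u 0, hu_ne 0, hGe', fun i v hv ↦ hG0 i v ((hbase i _).2 hv), fun n ↦ ?_,
    fun i v O w hO hi hw ↦ ?_⟩
  · exact congrFun hone n
  · rw [hu i v O w hO hi hw]
    exact thetaFunction_apply_eq_of_norm_eq_one Φ hψ hu_theta v 0

end KummerUnit

end Literature.AlgebraicGeometry.Motives.AbelianVariety

end
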